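import Summits.ValiantsHypothesis.ValiantsHypothesis.Theorems.KPlusLogSqLawStaticPathGlue
import Summits.ValiantsHypothesis.ValiantsHypothesis.Theorems.KPlusLogSqLawStaticPathCertEight

/-!
# Route «KPlusLogSqLaw» — parametric max-weight independent set on a path: all-`n` chain floors from one certificate (blocks + padding)

HONEST FRAMING.  Helper toward the crux `WeakLifting` (item `stmt-ValiantsHypothesis-19561`, route `KPlusLogSqLaw`, cell `pub-symmetroid`,
seat val-sym-lift-p4 g8, 2026-08-27) on the line of its witness-plan stub `stub_tridiagonalSectorB` (tropical twin of the STATIC tridiagonal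
sector = parametric maximum-weight independent set on a path).  Consequences of the gluing theorem `exists_chain_add`
(`KPlusLogSqLawStaticPathGlue`): `chain_congr` (transport along equal sizes), `exists_chain_zero` (the trivial chain on any block),
`exists_chain_pad` (more items never hurt), `exists_chain_blocks` (`k + 1` glued copies of one certificate: `N (k+1)` changes on
`n (k+1) + k` items) and the **ALL-`n` FLOOR FROM ONE CERTIFICATE** `exists_chain_floor`: a chain of `N` changes on `n` items gives, on every
block of `m` items, a chain of `N · ⌊(m+1)/(n+1)⌋` changes.  Instantiated here with the kernel certificate `exists_chain_twelve_on_eight`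
(`n = 8`, `N = 12`): `exists_chain_floor_eight`, rate `12/9 = 4/3` per item for all `m` (against rate `1` of `exists_chain_length`); the
`n = 15` certificate (rate `26/16`) is instantiated in its own file.  In the located theory (LINEAR-LAW) the truth is `2n - 4` for
`8 ≤ n ≤ 15`; these are kernel FLOORS only.  Nothing here asserts anything about `WeakLifting`, `TropicalB`, `KPlusLogSqLaw`, the stub in its
window, `MatrixDescartes` (stmt-ValiantsHypothesis-18050) or `VP ≠ VNP`.
-/

set_option linter.dupNamespace false
set_option autoImplicit false

namespace Summit.ValiantsHypothesis.ValiantsHypothesis.Theorems.KPlusLogSqLaw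

open Finset Classical

namespace StaticPathFold

noncomputable section

/-- transport of a chain certificate along equal sizes. [folklore] -/
theorem chain_congr {n n' N N' : ℕ} (hn : n = n') (hN : N = N')
    (h : ∃ (w₁ w₀ : ℕ → ℝ) (θs : Fin (N + 1) → ℝ) (Ms : Fin (N + 1) → Finset ℕ),
      StrictMono θs ∧ (∀ k, Ms k ∈ indepSets 0 n) ∧
      (∀ k, ∀ S ∈ indepSets 0 n, S ≠ Ms k → ∑ t ∈ S, W w₁ w₀ t (θs k) < ∑ t ∈ Ms k, W w₁ w₀ t (θs k)) ∧
      (∀ e : Fin N, Ms e.castSucc ≠ Ms e.succ)) :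
    ∃ (w₁ w₀ : ℕ → ℝ) (θs : Fin (N' + 1) → ℝ) (Ms : Fin (N' + 1) → Finset ℕ),
      StrictMono θs ∧ (∀ k, Ms k ∈ indepSets 0 n') ∧
      (∀ k, ∀ S ∈ indepSets 0 n', S ≠ Ms k → ∑ t ∈ S, W w₁ w₀ t (θs k) < ∑ t ∈ Ms k, W w₁ w₀ t (θs k)) ∧
      (∀ e : Fin N', Ms e.castSucc ≠ Ms e.succ) := by
  subst hn hN; exact h

/-- the trivial chain on any block: all weights `-1`, one sample, the empty set is the strict unique optimum. [folklore] -/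
theorem exists_chain_zero (n : ℕ) :
    ∃ (w₁ w₀ : ℕ → ℝ) (θs : Fin (0 + 1) → ℝ) (Ms : Fin (0 + 1) → Finset ℕ),
      StrictMono θs ∧ (∀ k, Ms k ∈ indepSets 0 n) ∧
      (∀ k, ∀ S ∈ indepSets 0 n, S ≠ Ms k → ∑ t ∈ S, W w₁ w₀ t (θs k) < ∑ t ∈ Ms k, W w₁ w₀ t (θs k)) ∧
      (∀ e : Fin 0, Ms e.castSucc ≠ Ms e.succ) := by
  refine ⟨fun _ => 0, fun _ => -1, fun _ => 0, fun _ => ∅, Fin.strictMono_iff_lt_succ.mpr fun e => e.elim0,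
    fun _ => empty_mem_indepSets 0 n, fun k S _ hne => ?_, fun e => e.elim0⟩
  have hcard : (0 : ℝ) < S.card := by exact_mod_cast Finset.card_pos.mpr (Finset.nonempty_iff_ne_empty.mpr hne)
  have h1 : ∑ t ∈ S, W (fun _ => (0 : ℝ)) (fun _ => (-1 : ℝ)) t 0 = -(S.card : ℝ) := by
    simp only [W, zero_mul, zero_add, Finset.sum_const, nsmul_eq_mul, mul_neg, mul_one]
  rw [h1, Finset.sum_empty]
  linarith

/-- **padding**: a chain on `n` items is a chain on `n + 1 + m` items (glue the trivial chain). [folklore] -/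
theorem exists_chain_pad {n N : ℕ}
    (h : ∃ (w₁ w₀ : ℕ → ℝ) (θs : Fin (N + 1) → ℝ) (Ms : Fin (N + 1) → Finset ℕ),
      StrictMono θs ∧ (∀ k, Ms k ∈ indepSets 0 n) ∧
      (∀ k, ∀ S ∈ indepSets 0 n, S ≠ Ms k → ∑ t ∈ S, W w₁ w₀ t (θs k) < ∑ t ∈ Ms k, W w₁ w₀ t (θs k)) ∧
      (∀ e : Fin N, Ms e.castSucc ≠ Ms e.succ)) (m : ℕ) :
    ∃ (w₁ w₀ : ℕ → ℝ) (θs : Fin (N + 1) → ℝ) (Ms : Fin (N + 1) → Finset ℕ),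
      StrictMono θs ∧ (∀ k, Ms k ∈ indepSets 0 (n + 1 + m)) ∧
      (∀ k, ∀ S ∈ indepSets 0 (n + 1 + m), S ≠ Ms k → ∑ t ∈ S, W w₁ w₀ t (θs k) < ∑ t ∈ Ms k, W w₁ w₀ t (θs k)) ∧
      (∀ e : Fin N, Ms e.castSucc ≠ Ms e.succ) :=
  chain_congr rfl (Nat.add_zero N) (exists_chain_add h (exists_chain_zero m))

/-- **blocks**: `k + 1` glued copies of a chain of `N` changes on `n` items give `N (k+1)` changes on `n (k+1) + k` items. [folklore] -/
theorem exists_chain_blocks {n N : ℕ}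
    (h : ∃ (w₁ w₀ : ℕ → ℝ) (θs : Fin (N + 1) → ℝ) (Ms : Fin (N + 1) → Finset ℕ),
      StrictMono θs ∧ (∀ k, Ms k ∈ indepSets 0 n) ∧
      (∀ k, ∀ S ∈ indepSets 0 n, S ≠ Ms k → ∑ t ∈ S, W w₁ w₀ t (θs k) < ∑ t ∈ Ms k, W w₁ w₀ t (θs k)) ∧
      (∀ e : Fin N, Ms e.castSucc ≠ Ms e.succ)) :
    ∀ k : ℕ, ∃ (w₁ w₀ : ℕ → ℝ) (θs : Fin (N * (k + 1) + 1) → ℝ) (Ms : Fin (N * (k + 1) + 1) → Finset ℕ),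
      StrictMono θs ∧ (∀ j, Ms j ∈ indepSets 0 (n * (k + 1) + k)) ∧
      (∀ j, ∀ S ∈ indepSets 0 (n * (k + 1) + k), S ≠ Ms j →
        ∑ t ∈ S, W w₁ w₀ t (θs j) < ∑ t ∈ Ms j, W w₁ w₀ t (θs j)) ∧
      (∀ e : Fin (N * (k + 1)), Ms e.castSucc ≠ Ms e.succ)
  | 0 => chain_congr (by ring) (by ring) h
  | k + 1 => chain_congr (by ring) (by ring) (exists_chain_add (exists_chain_blocks h k) h)

/-- **ALL-`n` FLOOR FROM ONE CERTIFICATE**: a chain of `N` changes on `n` items gives, on every block of `m` items, a chain of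
`N · ⌊(m+1)/(n+1)⌋` changes (blocks of `n` items separated by single items, the rest padded). [folklore] -/
theorem exists_chain_floor {n N : ℕ}
    (h : ∃ (w₁ w₀ : ℕ → ℝ) (θs : Fin (N + 1) → ℝ) (Ms : Fin (N + 1) → Finset ℕ),
      StrictMono θs ∧ (∀ k, Ms k ∈ indepSets 0 n) ∧
      (∀ k, ∀ S ∈ indepSets 0 n, S ≠ Ms k → ∑ t ∈ S, W w₁ w₀ t (θs k) < ∑ t ∈ Ms k, W w₁ w₀ t (θs k)) ∧
      (∀ e : Fin N, Ms e.castSucc ≠ Ms e.succ)) (m : ℕ) :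
    ∃ (w₁ w₀ : ℕ → ℝ) (θs : Fin (N * ((m + 1) / (n + 1)) + 1) → ℝ) (Ms : Fin (N * ((m + 1) / (n + 1)) + 1) → Finset ℕ),
      StrictMono θs ∧ (∀ j, Ms j ∈ indepSets 0 m) ∧
      (∀ j, ∀ S ∈ indepSets 0 m, S ≠ Ms j → ∑ t ∈ S, W w₁ w₀ t (θs j) < ∑ t ∈ Ms j, W w₁ w₀ t (θs j)) ∧
      (∀ e : Fin (N * ((m + 1) / (n + 1))), Ms e.castSucc ≠ Ms e.succ) := by
  rcases Nat.eq_zero_or_pos ((m + 1) / (n + 1)) with hq | hq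
  · rw [hq, Nat.mul_zero]; exact exists_chain_zero m
  · obtain ⟨k, hk⟩ : ∃ k, (m + 1) / (n + 1) = k + 1 := ⟨(m + 1) / (n + 1) - 1, by omega⟩
    rw [hk]
    have hle : (m + 1) / (n + 1) * (n + 1) ≤ m + 1 := Nat.div_mul_le_self (m + 1) (n + 1)
    rw [hk, show (k + 1) * (n + 1) = n * (k + 1) + k + 1 by ring] at hle
    rcases (show n * (k + 1) + k ≤ m by omega).eq_or_lt with he | hlt
    · exact chain_congr he rfl (exists_chain_blocks h k)
    · exact chain_congr (by omega) rfl (exists_chain_pad (exists_chain_blocks h k) (m - (n * (k + 1) + k) - 1))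

/-- **rate `4/3` for all `n`** (from the kernel certificate `exists_chain_twelve_on_eight`): every block of `m` items carries weights
affine in `θ` with a chain of `12 · ⌊(m+1)/9⌋` changes of the unique optimum. [folklore] -/
theorem exists_chain_floor_eight (m : ℕ) :
    ∃ (w₁ w₀ : ℕ → ℝ) (θs : Fin (12 * ((m + 1) / 9) + 1) → ℝ) (Ms : Fin (12 * ((m + 1) / 9) + 1) → Finset ℕ),
      StrictMono θs ∧ (∀ j, Ms j ∈ indepSets 0 m) ∧
      (∀ j, ∀ S ∈ indepSets 0 m, S ≠ Ms j → ∑ t ∈ S, W w₁ w₀ t (θs j) < ∑ t ∈ Ms j, W w₁ w₀ t (θs j)) ∧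
      (∀ e : Fin (12 * ((m + 1) / 9)), Ms e.castSucc ≠ Ms e.succ) :=
  exists_chain_floor exists_chain_twelve_on_eight m

end

end StaticPathFold

end Summit.ValiantsHypothesis.ValiantsHypothesis.Theorems.KPlusLogSqLaw
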